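import Summits.KontsevichZagierPeriods.KontsevichZagierPeriods.Theorems.RootDecompWalshStrataEulerDescent12

/-! # Root decomposition & Walsh strata — the conic-wall terminal, part 1: the class of the height
integrand (gen 8, §36.1–36.3)

Route `RootDecompWalshStrata`, leaf `QuadricBakerDescent` (stmt-27597), residual kind hW, E-type; this
is the CLASS half of residual R-E2 of NODE.md (decomp-kz-lens-4, gen 8): the boundary term of a sector
piece on an ADAPTED CONIC WALL.

In the sector chart of `InBaker.of_psector_walls` an adapted conic wall is `a(κ₀X² + κ₁Y²) + c = Λ(X,
Y)²` with a rational affine form `Λ = l₀ + l₁X + l₂Y` (on a wall `p∘ℓ = 0` of a wall family the fibre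
discriminant is the square `(2Aℓ + B)²`). In HEIGHT coordinates (`Y` the parameter, `X = X(Y)` along the
wall, `InBaker.psection_height`) the wall is the branch `X = (l₁L + εu)/k`, `L = l₀ + l₂Y`, `k = aκ₀ −
l₁²`, `u = √δ(Y)`, `δ = aκ₀L² − k(aκ₁Y² + c)` — ONE square root of a rational quadratic — and along it
`Λ = (aκ₀L + εl₁u)/k`, `X − YX′ = ε(l₀Λ − c)/u`, `κ₀X² + κ₁Y² = (Λ² − c)/a`, so that the height
integrand is `(γ/3)·|Λ³(l₀Λ − c)|/(u(Λ² − c))` (part 2, §36.4). THIS FILE puts that integrand in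
`InBaker` on the generic stratum (`δ` a non-degenerate quadratic): polynomial division `Λ³(l₀Λ − c) =
(l₀Λ² − cΛ + l₀c)(Λ² − c) + c²(l₀ − Λ)` and rationalisation by the conjugate branch (`k⁴(Λ² − c)(Λ̄² −
c) = R₄(Y) ∈ ℚ[Y]`) write it as `N₁(Y)/(R₄(Y)√δ) + M(Y)/R₄(Y)`; the second summand is rational and
bounded on the hull (`InBaker.peel_rat`), the first is the landed `InBaker.sqrt_rational_div`. Main
results: `ConicWall.terminal_identity`, `InBaker.conic_terminal_signed`, `InBaker.conic_terminal_abs`.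
[KontsevichZagier2001 §1.2 rules (1)–(3); Euler 1768 (second substitution); this node] -/

noncomputable section

open Set MeasureTheory Literature.NumberTheory.Transcendental
open Literature.ModelTheory.ExponentialFields (IsSemialgebraic isSemialgebraic_univ
  isSemialgebraic_setOf_eval_pos)

namespace Summit.KontsevichZagierPeriods.RootDecompWalshStrata.ConicDescent

/-! #### 36.1 Two small tools -/

/-- A representation whose integrand is a rational function on its domain is in `InBaker`.
[KontsevichZagier2001 §1.1] -/
theorem InBaker.of_isRatOn (r : KZ.IntegralRep 1) {F : (Fin 1 → ℝ) → ℝ} (hF : IsRatOn r.domain F)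
    (h : EqOn r.integrand F r.domain) : InBaker (KZ.of r) := by
  obtain ⟨p, q, hq, hpq⟩ := hF
  exact InBaker.of_eqOn_aeval_div r p q hq fun v hv => by rw [h hv, hpq v hv]

/-- **PEEL a rational summand.** On a domain inside a rational hull `[lo, hi]` on which `Q' ≠ 0`, an
integrand `N'/Q' + G` is in `InBaker` as soon as `[T, G]` is: `N'/Q'` is bounded and semialgebraic on
`T`, hence a (rational) representation of its own (`bddRep`), and `InBaker.of_sub'` subtracts it. [this
node] -/
theorem InBaker.peel_rat (N' Q' : Polynomial ℚ) (lo hi : ℚ)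
    (hQ' : ∀ x : ℝ, (lo : ℝ) ≤ x → x ≤ hi → Polynomial.aeval x Q' ≠ 0)
    (r : KZ.IntegralRep 1) (hdom : ∀ v ∈ r.domain, (lo : ℝ) ≤ v 0 ∧ v 0 ≤ hi)
    (G : (Fin 1 → ℝ) → ℝ)
    (hr : EqOn r.integrand (fun v => Polynomial.aeval (v 0) N' / Polynomial.aeval (v 0) Q' + G v)
      r.domain)
    (hB : ∀ rB : KZ.IntegralRep 1, rB.domain = r.domain → EqOn rB.integrand G rB.domain →
      InBaker (KZ.of rB)) :
    InBaker (KZ.of r) := by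
  have hSA := r.isSemialgebraic_domain
  have hsub : ∀ v ∈ r.domain, v 0 ∈ Icc (lo : ℝ) hi := fun v hv => ⟨(hdom v hv).1, (hdom v hv).2⟩
  have hb : Bornology.IsBounded r.domain :=
    (Metric.isBounded_Icc (fun _ : Fin 1 => (lo : ℝ)) (fun _ => (hi : ℝ))).subset fun v hv =>
      ⟨fun i => by rw [Subsingleton.elim i 0]; exact (hdom v hv).1,
        fun i => by rw [Subsingleton.elim i 0]; exact (hdom v hv).2⟩
  have hcont : ContinuousOn (fun x : ℝ => Polynomial.aeval x N' / Polynomial.aeval x Q')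
      (Icc (lo : ℝ) hi) :=
    (Polynomial.continuous_aeval N').continuousOn.div (Polynomial.continuous_aeval Q').continuousOn
      fun x hx => hQ' x hx.1 hx.2
  obtain ⟨M, hM⟩ := isCompact_Icc.exists_bound_of_continuousOn hcont
  have hRat : IsRatOn r.domain fun v => Polynomial.aeval (v 0) N' / Polynomial.aeval (v 0) Q' :=
    (IsRatOn.polyAeval N' IsRatOn.coord).div (IsRatOn.polyAeval Q' IsRatOn.coord) fun v hv =>
      hQ' _ (hdom v hv).1 (hdom v hv).2
  obtain ⟨rA, hAd, hAi⟩ : ∃ rA : KZ.IntegralRep 1, rA.domain = r.domain ∧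
      rA.integrand = fun v => Polynomial.aeval (v 0) N' / Polynomial.aeval (v 0) Q' :=
    ⟨bddRep r.domain hSA hb _ (hRat.isSemialgebraicFunOn hSA) M fun v hv => by
      rw [← Real.norm_eq_abs]; exact hM (v 0) (hsub v hv), rfl, rfl⟩
  refine InBaker.of_sub' r rA hAd
    (InBaker.of_isRatOn rA (hAd.symm ▸ hRat) fun v _ => by rw [hAi]) (hB _ rfl fun v hv => ?_)
  have hv' : v ∈ r.domain := hv
  show r.integrand v - rA.integrand v = G v
  rw [hAi, hr hv']
  ring

/-! #### 36.2 The conic-wall data and its polynomials -/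

/-- An adapted conic wall `a(κ₀X² + κ₁Y²) + c = (l₀ + l₁X + l₂Y)²` of a sector piece with weight
`γ√(a(κ₀X² + κ₁Y²) + c)`. [this node] -/
structure ConicWall where
  /-- the norm `κ₀X² + κ₁Y²` of the sector chart -/
  κ₀ : ℚ
  κ₁ : ℚ
  /-- the weight `γ√(a(κ₀X² + κ₁Y²) + c)` -/
  a : ℚ
  c : ℚ
  /-- the affine form `Λ = l₀ + l₁X + l₂Y` -/
  l₀ : ℚ
  l₁ : ℚ
  l₂ : ℚ

namespace ConicWall

variable (W : ConicWall)

/-- `k = aκ₀ − l₁²`, the leading coefficient of the wall as a quadratic in `X`. -/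
def k : ℚ := W.a * W.κ₀ - W.l₁ ^ 2

/-- `L(Y) = l₀ + l₂Y`. -/
def L (y : ℝ) : ℝ := W.l₀ + W.l₂ * y

/-- `P(Y) = aκ₀·L(Y)`. -/
def P (y : ℝ) : ℝ := W.a * W.κ₀ * W.L y

/-- The radicand `δ(Y) = aκ₀L² − k(aκ₁Y² + c)` of the branches `X = (l₁L ± √δ)/k`. -/
def δ (y : ℝ) : ℝ := W.a * W.κ₀ * W.L y ^ 2 - W.k * (W.a * W.κ₁ * y ^ 2 + W.c)

/-- `δ = eY² + fY + g`: the coefficient `e`. -/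
def δe : ℚ := W.a * W.κ₀ * W.l₂ ^ 2 - W.k * (W.a * W.κ₁)

/-- `δ = eY² + fY + g`: the coefficient `f`. -/
def δf : ℚ := 2 * W.a * W.κ₀ * W.l₀ * W.l₂

/-- `δ = eY² + fY + g`: the coefficient `g`. -/
def δg : ℚ := W.a * W.κ₀ * W.l₀ ^ 2 - W.k * W.c

/-- Auxiliary step `δ_eq_qD`. [bookkeeping] -/
theorem δ_eq_qD (y : ℝ) : W.δ y = qD W.δe W.δf W.δg y := by
  simp only [δ, L, k, qD, δe, δf, δg]
  push_cast
  ring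

/-- The branch value `Λ = (P + l₁√δ)/k` of the affine form along the wall (the other branch,
`(P − l₁√δ)/k`, is the `Λ` of the wall with `l₁ ↦ −l₁`, which has the same `k`, `P`, `δ`). -/
def Λ (y : ℝ) : ℝ := (W.P y + W.l₁ * √(W.δ y)) / W.k

/-- `L` as a polynomial. -/
def LY : Polynomial ℚ := Polynomial.C W.l₀ + Polynomial.C W.l₂ * Polynomial.X

/-- `P` as a polynomial. -/
def PY : Polynomial ℚ := Polynomial.C (W.a * W.κ₀) * W.LY

/-- `δ` as a polynomial. -/
def δY : Polynomial ℚ :=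
  Polynomial.C (W.a * W.κ₀) * W.LY ^ 2 -
    Polynomial.C W.k * (Polynomial.C (W.a * W.κ₁) * Polynomial.X ^ 2 + Polynomial.C W.c)

/-- Auxiliary step `aeval_LY`. [bookkeeping] -/
theorem aeval_LY (y : ℝ) : Polynomial.aeval y W.LY = W.L y := by
  simp [LY, L]

/-- Auxiliary step `aeval_PY`. [bookkeeping] -/
theorem aeval_PY (y : ℝ) : Polynomial.aeval y W.PY = W.P y := by
  simp [PY, P, aeval_LY]

/-- Auxiliary step `aeval_δY`. [bookkeeping] -/
theorem aeval_δY (y : ℝ) : Polynomial.aeval y W.δY = W.δ y := by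
  simp [δY, δ, aeval_LY]

/-- `R₄ = (P² − l₁²δ)² − 2ck²(P² + l₁²δ) + c²k⁴ = k⁴(Λ² − c)(Λ̄² − c)`. -/
def R4Y : Polynomial ℚ :=
  (W.PY ^ 2 - Polynomial.C (W.l₁ ^ 2) * W.δY) ^ 2 -
    Polynomial.C (2 * W.c * W.k ^ 2) * (W.PY ^ 2 + Polynomial.C (W.l₁ ^ 2) * W.δY) +
      Polynomial.C (W.c ^ 2 * W.k ^ 4)

/-- `A₁ = l₀(P² + l₁²δ)/k² − cP/k + l₀c`. -/
def A₁Y : Polynomial ℚ :=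
  Polynomial.C (W.l₀ / W.k ^ 2) * (W.PY ^ 2 + Polynomial.C (W.l₁ ^ 2) * W.δY) -
    Polynomial.C (W.c / W.k) * W.PY + Polynomial.C (W.l₀ * W.c)

/-- `B₁ = 2l₀l₁P/k² − cl₁/k`. -/
def B₁Y : Polynomial ℚ :=
  Polynomial.C (2 * W.l₀ * W.l₁ / W.k ^ 2) * W.PY - Polynomial.C (W.c * W.l₁ / W.k)

/-- `A₂ = (l₀k − P)(P² + l₁²δ − ck²) + 2l₁²Pδ`. -/
def A₂Y : Polynomial ℚ :=
  (Polynomial.C (W.l₀ * W.k) - W.PY) * (W.PY ^ 2 + Polynomial.C (W.l₁ ^ 2) * W.δY -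
    Polynomial.C (W.c * W.k ^ 2)) + Polynomial.C (2 * W.l₁ ^ 2) * W.PY * W.δY

/-- `B₂ = −l₁(P² + l₁²δ − ck²) − 2l₁P(l₀k − P)`. -/
def B₂Y : Polynomial ℚ :=
  -(Polynomial.C W.l₁ * (W.PY ^ 2 + Polynomial.C (W.l₁ ^ 2) * W.δY - Polynomial.C (W.c * W.k ^ 2))) -
    Polynomial.C (2 * W.l₁) * W.PY * (Polynomial.C (W.l₀ * W.k) - W.PY)

/-- The numerator `N₁ = (γs/3)(A₁R₄ + c²kA₂)` of the `1/√δ` part. -/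
def N₁Y (γ s : ℚ) : Polynomial ℚ :=
  Polynomial.C (γ * s / 3) * (W.A₁Y * W.R4Y + Polynomial.C (W.c ^ 2 * W.k) * W.A₂Y)

/-- The numerator `M = (γs/3)(B₁R₄ + c²kB₂)` of the rational part. -/
def MY (γ s : ℚ) : Polynomial ℚ :=
  Polynomial.C (γ * s / 3) * (W.B₁Y * W.R4Y + Polynomial.C (W.c ^ 2 * W.k) * W.B₂Y)

/-- `R₄ = (kΛ)² − ck²)·((kΛ̄)² − ck²)` wherever `δ ≥ 0` (`Λ̄` the conjugate branch). [this node] -/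
theorem aeval_R4Y (y : ℝ) (hδ : 0 ≤ W.δ y) :
    Polynomial.aeval y W.R4Y =
      ((W.P y + W.l₁ * √(W.δ y)) ^ 2 - W.c * W.k ^ 2) *
        ((W.P y - W.l₁ * √(W.δ y)) ^ 2 - W.c * W.k ^ 2) := by
  simp only [R4Y, map_add, map_sub, map_mul, map_pow, Polynomial.aeval_C, aeval_PY, aeval_δY,
    eq_ratCast]
  set u := √(W.δ y) with hu_def
  have hu : u ^ 2 = W.δ y := by rw [hu_def]; exact Real.sq_sqrt hδ
  rw [← hu]
  push_cast
  ring

/-- **THE TERMINAL IDENTITY.**  On the branch, with `u = √δ > 0` and `R₄ ≠ 0`: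
`(γs/3)·Λ³(l₀Λ − c)/(u(Λ² − c)) = N₁/(R₄u) + M/R₄` — polynomial division by `Λ² − c` and
rationalisation by the conjugate branch. [this node] -/
theorem terminal_identity (γ s : ℚ) (hk : W.k ≠ 0) (y : ℝ) (hδ : 0 < W.δ y)
    (hR4 : Polynomial.aeval y W.R4Y ≠ 0) :
    (γ * s / 3 : ℝ) * W.Λ y ^ 3 * (W.l₀ * W.Λ y - W.c) / (√(W.δ y) * (W.Λ y ^ 2 - W.c)) =
      Polynomial.aeval y (W.N₁Y γ s) / Polynomial.aeval y W.R4Y / √(qD W.δe W.δf W.δg y) +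
        Polynomial.aeval y (W.MY γ s) / Polynomial.aeval y W.R4Y := by
  have hR := W.aeval_R4Y y hδ.le
  have hk' : (W.k : ℝ) ≠ 0 := by exact_mod_cast hk
  rw [← δ_eq_qD]
  simp only [N₁Y, MY, A₁Y, B₁Y, A₂Y, B₂Y, map_add, map_sub, map_mul, map_pow, map_neg,
    Polynomial.aeval_C, aeval_PY, aeval_δY, eq_ratCast, Λ]
  set u := √(W.δ y) with hu_def
  have hu0 : u ≠ 0 := by rw [hu_def]; exact (Real.sqrt_pos.2 hδ).ne'
  have hu : u ^ 2 = W.δ y := by rw [hu_def]; exact Real.sq_sqrt hδ.le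
  set D := (W.P y + (W.l₁ : ℝ) * u) ^ 2 - (W.c : ℝ) * (W.k : ℝ) ^ 2 with hD
  set D' := (W.P y - (W.l₁ : ℝ) * u) ^ 2 - (W.c : ℝ) * (W.k : ℝ) ^ 2 with hD'
  have hΛk : D ≠ 0 := fun h => hR4 (by rw [hR, h, zero_mul])
  have hΛk' : D' ≠ 0 := fun h => hR4 (by rw [hR, h, mul_zero])
  rw [← hu]
  have hrew : ((W.P y + W.l₁ * u) / W.k) ^ 2 - W.c = D / (W.k : ℝ) ^ 2 := by
    rw [hD]
    field_simp
  rw [hrew]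
  push_cast
  field_simp
  rw [hR, hD, hD']
  ring

/-- `Λ` is a `ℚ`-semialgebraic function of the height. [BCR1998 §2.2] -/
theorem isSemialgebraicFunOn_Λ {T : Set (Fin 1 → ℝ)} (hT : IsSemialgebraic ℚ T) :
    IsSemialgebraicFunOn ℚ T fun v => W.Λ (v 0) := by
  have hδ : IsSemialgebraicFunOn ℚ T fun v => W.δ (v 0) :=
    (isSemialgebraicFunOn_qD W.δe W.δf W.δg hT).congr fun v _ => by rw [W.δ_eq_qD]
  have hP : IsSemialgebraicFunOn ℚ T fun v => W.P (v 0) :=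
    ((IsRatOn.polyAeval W.PY IsRatOn.coord).isSemialgebraicFunOn hT).congr fun v _ =>
      W.aeval_PY (v 0)
  exact ((isSemialgebraicFunOn_ratCast hT (1 / W.k)).mul_holds (hP.add_holds
    ((isSemialgebraicFunOn_ratCast hT W.l₁).mul_holds
      (IsSemialgebraicFunOn.sqrt_holds hδ)))).congr fun v _ => by
    simp only [Pi.mul_apply, Pi.add_apply, Λ]
    push_cast
    ring

end ConicWall

/-! #### 36.3 The class of the conic-wall height integrand (generic stratum) -/

/-- **SIGNED CONIC TERMINAL.** On the generic stratum (`δ` a non-degenerate quadratic), a rational hull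
on which `R₄ ≠ 0`, and a domain on which `δ > 0`: `[T, (γs/3)·Λ³(l₀Λ − c)/(√δ(Λ² − c))] ∈ InBaker` —
peel the rational part `M/R₄` (`InBaker.peel_rat`); the rest is `N₁/R₄/√δ` (`InBaker.sqrt_rational_div`,
landed). [this node] -/
theorem InBaker.conic_terminal_signed (W : ConicWall) (γ s : ℚ) (hk : W.k ≠ 0) (he : W.δe ≠ 0)
    (hh : W.δg - W.δf ^ 2 / (4 * W.δe) ≠ 0) (lo hi : ℚ)
    (hR4 : ∀ x : ℝ, (lo : ℝ) ≤ x → x ≤ hi → Polynomial.aeval x W.R4Y ≠ 0)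
    (r : KZ.IntegralRep 1) (hdom : ∀ v ∈ r.domain, (lo : ℝ) ≤ v 0 ∧ v 0 ≤ hi)
    (hδ : ∀ v ∈ r.domain, 0 < W.δ (v 0))
    (hr : EqOn r.integrand (fun v => (γ * s / 3 : ℝ) * W.Λ (v 0) ^ 3 *
      (W.l₀ * W.Λ (v 0) - W.c) / (√(W.δ (v 0)) * (W.Λ (v 0) ^ 2 - W.c))) r.domain) :
    InBaker (KZ.of r) := by
  refine InBaker.peel_rat (W.MY γ s) W.R4Y lo hi hR4 r hdom
    (fun v => Polynomial.aeval (v 0) (W.N₁Y γ s) / Polynomial.aeval (v 0) W.R4Y /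
      √(qD W.δe W.δf W.δg (v 0))) (fun v hv => ?_) fun rB hBd hBi => ?_
  · rw [hr hv]
    beta_reduce
    rw [W.terminal_identity γ s hk (v 0) (hδ v hv) (hR4 _ (hdom v hv).1 (hdom v hv).2)]
    ring
  · exact InBaker.sqrt_rational_div W.δe W.δf W.δg he hh (W.N₁Y γ s) W.R4Y lo hi hR4 rB
      (fun v hv => hdom v (by rw [hBd] at hv; exact hv)) hBi

/-- **CONIC TERMINAL (absolute value).**  Same, for the actual height integrand
`(γ/3)·|Λ³(l₀Λ − c)|/(√δ(Λ² − c))`: split the domain by the sign of the semialgebraic function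
`Λ³(l₀Λ − c)` (`InBaker.of_split`) and apply the signed terminal with `s = ±1`. [this node] -/
theorem InBaker.conic_terminal_abs (W : ConicWall) (γ : ℚ) (hk : W.k ≠ 0) (he : W.δe ≠ 0)
    (hh : W.δg - W.δf ^ 2 / (4 * W.δe) ≠ 0) (lo hi : ℚ)
    (hR4 : ∀ x : ℝ, (lo : ℝ) ≤ x → x ≤ hi → Polynomial.aeval x W.R4Y ≠ 0)
    (r : KZ.IntegralRep 1) (hdom : ∀ v ∈ r.domain, (lo : ℝ) ≤ v 0 ∧ v 0 ≤ hi)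
    (hδ : ∀ v ∈ r.domain, 0 < W.δ (v 0))
    (hr : EqOn r.integrand (fun v => (γ / 3 : ℝ) * |W.Λ (v 0) ^ 3 * (W.l₀ * W.Λ (v 0) - W.c)| /
      (√(W.δ (v 0)) * (W.Λ (v 0) ^ 2 - W.c))) r.domain) :
    InBaker (KZ.of r) := by
  have hSA := r.isSemialgebraic_domain
  have hΛ := W.isSemialgebraicFunOn_Λ hSA
  have hGsa : IsSemialgebraicFunOn ℚ r.domain fun v =>
      W.Λ (v 0) ^ 3 * (W.l₀ * W.Λ (v 0) - W.c) :=
    ((hΛ.mul_holds (hΛ.mul_holds hΛ)).mul_holds (((isSemialgebraicFunOn_ratCast hSA W.l₀).mul_holds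
      hΛ).sub_holds (isSemialgebraicFunOn_ratCast hSA W.c))).congr fun v _ => by
      simp only [Pi.mul_apply, Pi.sub_apply]; ring
  have hB : IsSemialgebraic ℚ {v | v ∈ r.domain ∧
      W.Λ (v 0) ^ 3 * (W.l₀ * W.Λ (v 0) - W.c) < 0} := hGsa.isSemialgebraic_sep_neg
  have hBr : {v | v ∈ r.domain ∧ W.Λ (v 0) ^ 3 * (W.l₀ * W.Λ (v 0) - W.c) < 0} ⊆ r.domain :=
    fun v hv => hv.1
  have hA : IsSemialgebraic ℚ (r.domain \ {v | v ∈ r.domain ∧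
      W.Λ (v 0) ^ 3 * (W.l₀ * W.Λ (v 0) - W.c) < 0}) := hSA.diff hB
  refine InBaker.of_split r hA hB sdiff_subset hBr (sdiff_union_of_subset hBr).symm
    (by rw [sdiff_inter_self, measure_empty]) ?_ ?_
  · refine InBaker.conic_terminal_signed W γ 1 hk he hh lo hi hR4 _
      (fun v hv => hdom v (sdiff_subset hv)) (fun v hv => hδ v (sdiff_subset hv)) fun v hv => ?_
    have hv' : v ∈ r.domain := sdiff_subset hv
    have hG0 : 0 ≤ W.Λ (v 0) ^ 3 * (W.l₀ * W.Λ (v 0) - W.c) :=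
      not_lt.1 fun h => ((mem_sdiff v).1 hv).2 ⟨hv', h⟩
    show r.integrand v = _
    rw [hr hv']
    beta_reduce
    rw [abs_of_nonneg hG0]
    push_cast
    ring
  · refine InBaker.conic_terminal_signed W γ (-1) hk he hh lo hi hR4 _
      (fun v hv => hdom v (hBr hv)) (fun v hv => hδ v (hBr hv)) fun v hv => ?_
    have hv' : v ∈ r.domain := hBr hv
    have hG0 : W.Λ (v 0) ^ 3 * (W.l₀ * W.Λ (v 0) - W.c) < 0 := by
      have h : v ∈ {v | v ∈ r.domain ∧ W.Λ (v 0) ^ 3 * (W.l₀ * W.Λ (v 0) - W.c) < 0} := hv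
      exact h.2
    show r.integrand v = _
    rw [hr hv']
    beta_reduce
    rw [abs_of_neg hG0]
    push_cast
    ring

end Summit.KontsevichZagierPeriods.RootDecompWalshStrata.ConicDescent

end
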